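import Summits.RiemannHypothesis.RiemannHypothesis.Theses.WeilComb
import Summits.RiemannHypothesis.RiemannHypothesis.Theorems.WeilCombCombShapeAdmissible
import Summits.RiemannHypothesis.RiemannHypothesis.Theorems.WeilCombCombShapePositivityPoleCoefficient
import Summits.RiemannHypothesis.RiemannHypothesis.Theorems.WeilCombCombShapePositivitySharpArchDiag
import Literature.NumberTheory.LFunctions.WeilExplicit
import Literature.NumberTheory.LFunctions.WeilMellinBounds
import Literature.NumberTheory.LFunctions.WeilArchimedeanMoments

/-!
# Stub `stub_subDiagPole` of line `Sketch` for crux `WeilComb.CombShapePositivity`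
(item stmt-RiemannHypothesis-11229, route route-RiemannHypothesis-WeilComb)

The three analytic constants of the fixed bump `φ₀(u) = expNegInvGlue (1 - u²)` consumed by the effective
subcritical window (`stub_windowSub` / `assemble_sub` of the skeleton), with `φ_ε(t) = ε⁻¹ φ₀(t/ε)`,
`ψ_ε = φ_ε ⋆ φ̃_ε`, `N = ‖φ₀‖₂²` (`weilNorm2Sq`), `I₀ = ∫ φ₀`:

* (a) sharp archimedean diagonal `Re W_∞(ψ_ε) ≥ ε⁻¹N(log(1/ε) − 5/2) − N(9 + 3 log(1/ε))` for `0 < ε ≤ 1/4`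
  — the case `g = φ_ε`, `b = ε` of `re_weilArchTerm_autocorr_ge_sharp` (`‖φ_ε‖₂² = ε⁻¹N`);
* (b) pole coefficients `‖φ̂_ε(0)‖, ‖φ̂_ε(1)‖ ≤ e^{ε/2} I₀` — both equal `∫ φ₀(u) cosh(εu/2) du`
  (`weilMellin_dilBump_zero_one`, p92438) and `cosh(εu/2) ≤ e^{ε/2}` on the support `|u| ≤ 1`;
* (c) Cauchy–Schwarz on `[-1, 1]`: `I₀² ≤ 2N` (`weilNorm1_sq_le`, `weilNorm1 φ₀ = I₀`).
-/

noncomputable section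

-- the sub-problem path RiemannHypothesis/RiemannHypothesis duplicates a namespace (D-0017)
set_option linter.dupNamespace false

open scoped BigOperators ComplexConjugate
open Complex MeasureTheory Set

namespace Summit.RiemannHypothesis.RiemannHypothesis.Theorems.WeilCombBohrFejer

open Literature.NumberTheory.LFunctions

/-! ### Dilation toolkit (adapted from `WeilCombCombSubcriticalStubArch.lean`, private there) -/

/-- `φ_ε` is a Weil test function (`ε ≠ 0`). [folklore] -/
private theorem isWeilTest_dil_subDiagPole {φ : ℝ → ℂ} {ε : ℝ} (hφ : IsWeilTest φ) (hε : ε ≠ 0) :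
    IsWeilTest (fun t : ℝ => (ε : ℂ)⁻¹ * φ (t / ε)) := by
  -- adapted from `WeilCombSubcritical.isWeilTest_dil_arch`
  have h1 : IsWeilTest (fun t : ℝ => φ (t / ε)) := by
    refine ⟨hφ.1.comp (contDiff_id.div_const ε), ?_⟩
    have e : (fun t : ℝ => φ (t / ε)) = φ ∘ (Homeomorph.mulRight₀ ε⁻¹ (inv_ne_zero hε)) := by
      ext t
      simp [div_eq_mul_inv]
    rw [e]
    exact hφ.2.comp_homeomorph _
  exact h1.const_mul _

/-- `tsupport φ ⊆ [-1, 1]` gives `tsupport φ_ε ⊆ [-ε, ε]` (`ε > 0`). [folklore] -/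
private theorem tsupport_dil_subset_subDiagPole {φ : ℝ → ℂ} {ε : ℝ} (hsupp : tsupport φ ⊆ Icc (-1) 1)
    (hε : 0 < ε) : tsupport (fun t : ℝ => (ε : ℂ)⁻¹ * φ (t / ε)) ⊆ Icc (-ε) ε := by
  -- adapted from `WeilCombSubcritical.tsupport_dil_subset_arch`
  refine closure_minimal ?_ isClosed_Icc
  intro t ht
  rw [Function.mem_support] at ht
  have hφ : φ (t / ε) ≠ 0 := fun h => ht (by simp [h])
  have hmem : t / ε ∈ Icc (-1 : ℝ) 1 := hsupp (subset_tsupport _ hφ)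
  constructor
  · have h := hmem.1
    rw [le_div_iff₀ hε] at h
    linarith
  · have h := hmem.2
    rw [div_le_iff₀ hε] at h
    linarith

/-- `‖φ_ε‖₂² = ε⁻¹ ‖φ‖₂²` (`ε > 0`). [folklore] -/
private theorem weilNorm2Sq_dil_subDiagPole (φ : ℝ → ℂ) {ε : ℝ} (hε : 0 < ε) :
    weilNorm2Sq (fun t : ℝ => (ε : ℂ)⁻¹ * φ (t / ε)) = ε⁻¹ * weilNorm2Sq φ := by
  -- adapted from `WeilCombSubcritical.weilNorm2Sq_dil_arch`
  unfold weilNorm2Sq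
  have e : (fun t : ℝ => ‖(ε : ℂ)⁻¹ * φ (t / ε)‖ ^ 2) = fun t => (ε⁻¹) ^ 2 * ‖φ (t / ε)‖ ^ 2 := by
    funext t
    rw [norm_mul, norm_inv, Complex.norm_real, Real.norm_eq_abs, abs_of_pos hε, mul_pow]
  rw [e, integral_const_mul, Measure.integral_comp_div (fun t => ‖φ t‖ ^ 2) ε, abs_of_pos hε,
    smul_eq_mul]
  field_simp

/-! ### The bump: `I₀ = ‖φ₀‖₁`, and the `cosh`-moment bound -/

/-- `weilNorm1 φ₀ = ∫ φ₀` (the bump is real and nonnegative). [folklore] -/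
private theorem weilNorm1_shapeBump_subDiagPole :
    weilNorm1 (fun u : ℝ => ((expNegInvGlue (1 - u ^ 2) : ℝ) : ℂ)) = ∫ u : ℝ, expNegInvGlue (1 - u ^ 2) := by
  unfold weilNorm1
  congr 1 with u
  rw [Complex.norm_real, Real.norm_eq_abs, abs_of_nonneg (expNegInvGlue.nonneg _)]

/-- The `cosh`-moment is at most `e^{ε/2} I₀`: `∫ φ₀(u) cosh(εu/2) du ≤ e^{ε/2} ∫ φ₀` (`ε ≥ 0`),
since `φ₀ ≥ 0` vanishes off `[-1, 1]` and `cosh(εu/2) ≤ e^{|εu/2|} ≤ e^{ε/2}` there. [folklore] -/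
private theorem integral_shapeBump_mul_cosh_le_subDiagPole {ε : ℝ} (hε : 0 ≤ ε) :
    ∫ u : ℝ, expNegInvGlue (1 - u ^ 2) * Real.cosh (ε * u / 2) ≤
      Real.exp (ε / 2) * ∫ u : ℝ, expNegInvGlue (1 - u ^ 2) := by
  rw [← integral_const_mul]
  -- integrability of the majorant: continuous with compact support
  have hcont : Continuous fun u : ℝ => expNegInvGlue (1 - u ^ 2) :=
    (expNegInvGlue.contDiff (n := 0)).continuous.comp (continuous_const.sub (continuous_id.pow 2))
  have hsupp : Function.support (fun u : ℝ => expNegInvGlue (1 - u ^ 2)) ⊆ Icc (-1) 1 := by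
    intro u hu
    by_contra h
    apply hu
    have h1 : 1 - u ^ 2 ≤ 0 := by
      simp only [mem_Icc, not_and_or, not_le] at h
      rcases h with h | h <;> nlinarith
    exact expNegInvGlue.zero_of_nonpos h1
  have hcs : HasCompactSupport fun u : ℝ => expNegInvGlue (1 - u ^ 2) :=
    HasCompactSupport.of_support_subset_isCompact isCompact_Icc hsupp
  have hint : Integrable fun u : ℝ => Real.exp (ε / 2) * expNegInvGlue (1 - u ^ 2) :=
    (hcont.integrable_of_hasCompactSupport hcs).const_mul _
  refine integral_mono_of_nonneg (Filter.Eventually.of_forall fun u => ?_) hint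
    (Filter.Eventually.of_forall fun u => ?_)
  · exact mul_nonneg (expNegInvGlue.nonneg _) (Real.cosh_pos _).le
  · -- pointwise: `φ₀(u) cosh(εu/2) ≤ e^{ε/2} φ₀(u)`
    show expNegInvGlue (1 - u ^ 2) * Real.cosh (ε * u / 2) ≤ Real.exp (ε / 2) * expNegInvGlue (1 - u ^ 2)
    have h0 : 0 ≤ expNegInvGlue (1 - u ^ 2) := expNegInvGlue.nonneg _
    by_cases hu : |u| ≤ 1
    · have hc : Real.cosh (ε * u / 2) ≤ Real.exp (ε / 2) := by
        have hab : |ε * u / 2| ≤ ε / 2 := by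
          rw [abs_div, abs_mul, abs_of_nonneg hε, abs_of_pos (by norm_num : (0 : ℝ) < 2)]
          have : ε * |u| ≤ ε * 1 := mul_le_mul_of_nonneg_left hu hε
          linarith [div_le_div_of_nonneg_right this (by norm_num : (0 : ℝ) ≤ 2)]
        have hcosh : Real.cosh (ε * u / 2) ≤ Real.exp |ε * u / 2| := by
          rw [Real.cosh_eq]
          have e1 := Real.exp_le_exp.2 (le_abs_self (ε * u / 2))
          have e2 := Real.exp_le_exp.2 (neg_le_abs (ε * u / 2))
          linarith
        exact hcosh.trans (Real.exp_le_exp.2 hab)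
      calc expNegInvGlue (1 - u ^ 2) * Real.cosh (ε * u / 2)
          ≤ expNegInvGlue (1 - u ^ 2) * Real.exp (ε / 2) := mul_le_mul_of_nonneg_left hc h0
        _ = Real.exp (ε / 2) * expNegInvGlue (1 - u ^ 2) := mul_comm _ _
    · have h1 : 1 - u ^ 2 ≤ 0 := by
        rw [not_le] at hu
        have : 1 < u ^ 2 := by
          rw [← sq_abs]; nlinarith [abs_nonneg u]
        linarith
      rw [expNegInvGlue.zero_of_nonpos h1]
      simp

/-! ### The stub -/

/-- **Stub S1 — analytic constants of the fixed bump** (registered signature of skeleton v5, line `Sketch`).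
(a) Sharp archimedean diagonal: for `0 < ε ≤ 1/4`, `Re W_∞(ψ_ε) ≥ ε⁻¹N(log(1/ε) − 5/2) − N(9 + 3 log(1/ε))`
(`re_weilArchTerm_autocorr_ge_sharp` at `g = φ_ε`, `b = ε`, `‖φ_ε‖₂² = ε⁻¹N`). (b) Pole coefficients:
`‖φ̂_ε(0)‖, ‖φ̂_ε(1)‖ ≤ e^{ε/2} I₀` (p92438 `weilMellin_dilBump_zero_one` + `cosh ≤ exp` on the support).
(c) Cauchy–Schwarz on `[-1,1]`: `I₀² ≤ 2N` (`weilNorm1_sq_le`). [folklore] -/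
theorem stub_subDiagPole :
    (∀ ε : ℝ, 0 < ε → ε ≤ 1 / 4 →
      ε⁻¹ * weilNorm2Sq (fun u : ℝ => ((expNegInvGlue (1 - u ^ 2) : ℝ) : ℂ)) * (Real.log (1 / ε) - 5 / 2) -
          weilNorm2Sq (fun u : ℝ => ((expNegInvGlue (1 - u ^ 2) : ℝ) : ℂ)) * (9 + 3 * Real.log (1 / ε)) ≤
        (weilArchTerm
          (weilConv (fun t : ℝ => (ε : ℂ)⁻¹ * ((expNegInvGlue (1 - (t / ε) ^ 2) : ℝ) : ℂ))
            (weilReflect (fun t : ℝ => (ε : ℂ)⁻¹ * ((expNegInvGlue (1 - (t / ε) ^ 2) : ℝ) : ℂ))))).re) ∧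
    (∀ ε : ℝ, 0 < ε →
      ‖weilMellin (fun t : ℝ => (ε : ℂ)⁻¹ * ((expNegInvGlue (1 - (t / ε) ^ 2) : ℝ) : ℂ)) 0‖ ≤
          Real.exp (ε / 2) * ∫ u : ℝ, expNegInvGlue (1 - u ^ 2) ∧
      ‖weilMellin (fun t : ℝ => (ε : ℂ)⁻¹ * ((expNegInvGlue (1 - (t / ε) ^ 2) : ℝ) : ℂ)) 1‖ ≤
          Real.exp (ε / 2) * ∫ u : ℝ, expNegInvGlue (1 - u ^ 2)) ∧
    (∫ u : ℝ, expNegInvGlue (1 - u ^ 2)) ^ 2 ≤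
      2 * weilNorm2Sq (fun u : ℝ => ((expNegInvGlue (1 - u ^ 2) : ℝ) : ℂ)) := by
  have hφ : IsWeilTest (fun u : ℝ => ((expNegInvGlue (1 - u ^ 2) : ℝ) : ℂ)) :=
    Summit.RiemannHypothesis.RiemannHypothesis.Theorems.weilComb_shapeBump_isWeilTest
  have hφs : tsupport (fun u : ℝ => ((expNegInvGlue (1 - u ^ 2) : ℝ) : ℂ)) ⊆ Icc (-1) 1 :=
    Summit.RiemannHypothesis.RiemannHypothesis.Theorems.weilComb_shapeBump_tsupport_subset
  refine ⟨fun ε hε hε4 => ?_, fun ε hε => ?_, ?_⟩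
  · -- (a) specialise the sharp diagonal estimate to `g = φ_ε`, `b = ε`
    set N : ℝ := weilNorm2Sq (fun u : ℝ => ((expNegInvGlue (1 - u ^ 2) : ℝ) : ℂ)) with hNdef
    have hW : IsWeilTest (fun t : ℝ => (ε : ℂ)⁻¹ * ((expNegInvGlue (1 - (t / ε) ^ 2) : ℝ) : ℂ)) :=
      isWeilTest_dil_subDiagPole (φ := fun u : ℝ => ((expNegInvGlue (1 - u ^ 2) : ℝ) : ℂ)) hφ hε.ne'
    have hs : tsupport (fun t : ℝ => (ε : ℂ)⁻¹ * ((expNegInvGlue (1 - (t / ε) ^ 2) : ℝ) : ℂ)) ⊆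
        Icc (-ε) ε :=
      tsupport_dil_subset_subDiagPole (φ := fun u : ℝ => ((expNegInvGlue (1 - u ^ 2) : ℝ) : ℂ)) hφs hε
    have hN : weilNorm2Sq (fun t : ℝ => (ε : ℂ)⁻¹ * ((expNegInvGlue (1 - (t / ε) ^ 2) : ℝ) : ℂ)) =
        ε⁻¹ * N :=
      weilNorm2Sq_dil_subDiagPole (fun u : ℝ => ((expNegInvGlue (1 - u ^ 2) : ℝ) : ℂ)) hε
    have h := re_weilArchTerm_autocorr_ge_sharp hW hε hε4 hs
    rw [hN] at h
    have e : (Real.log (1 / ε) - 5 / 2) * (ε⁻¹ * N) - ε * (9 + 3 * Real.log (1 / ε)) * (ε⁻¹ * N) =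
        ε⁻¹ * N * (Real.log (1 / ε) - 5 / 2) - N * (9 + 3 * Real.log (1 / ε)) := by
      field_simp
    rw [e] at h
    exact h
  · -- (b) pole coefficients
    obtain ⟨h0, h1, _⟩ := weilMellin_dilBump_zero_one ε hε
    have hle := integral_shapeBump_mul_cosh_le_subDiagPole hε.le
    have hnn : 0 ≤ ∫ u : ℝ, expNegInvGlue (1 - u ^ 2) * Real.cosh (ε * u / 2) :=
      integral_nonneg fun u => mul_nonneg (expNegInvGlue.nonneg _) (Real.cosh_pos _).le
    have hnorm : ‖((∫ u : ℝ, expNegInvGlue (1 - u ^ 2) * Real.cosh (ε * u / 2) : ℝ) : ℂ)‖ =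
        ∫ u : ℝ, expNegInvGlue (1 - u ^ 2) * Real.cosh (ε * u / 2) := by
      rw [Complex.norm_real, Real.norm_eq_abs, abs_of_nonneg hnn]
    rw [h0, h1, hnorm]
    exact ⟨hle, hle⟩
  · -- (c) Cauchy–Schwarz on `[-1, 1]`
    have h := weilNorm1_sq_le hφ one_pos hφs
    rw [weilNorm1_shapeBump_subDiagPole] at h
    linarith

end Summit.RiemannHypothesis.RiemannHypothesis.Theorems.WeilCombBohrFejer

end
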